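import Mathlib
import HarnessLib
import Summits.Ventures.LatticeQCDFlow.Exactness.IMHDelayedRejectionBestOfTwo

/-!
# LatticeQCDFlow / Exactness — GLOBAL FIRST, LOCAL SECOND DOES NOT STICK: if the second-stage move never lowers the weight by more than a factor `1 − ε`,
# the delayed-rejection flow sampler with a local second stage MOVES with probability at least `1 − ε` from EVERY configuration

HONEST FRAMING: exact (Metropolis-corrected) sampling algorithms for lattice gauge theory;
figures of merit are autocorrelation/cost numbers at stated couplings and volumes; no
continuum-physics claim.

Venture `LatticeQCDFlow` (cell pub-lqcd), topic `Exactness`, FANOUT row 30 (lean-1 GEN-43; joins `IMHDelayedRejectionBestOfTwo` (the closed form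
`d(x, y₁, z) = (min(w x, w z) − w y₁)⁺/w x` of the Tierney–Mira second stage) and `IMHDelayedRejectionReversibleSecondStage` (the exact sampler
"independent flow draw first, `q`-reversible local move second")).  NEW WORK of the cell; no definition is introduced, nothing is cited as a fact.
Contrast: with an INDEPENDENT second draw the move probability from a configuration of weight `w(x)` is at most `2Z/w(x)`
(`IMHDelayedRejectionStickingFloor`); the local second stage removes the floor — the chain no longer freezes at heavy configurations, it creeps.

## Setting (general measurable `Ω`; flow law `q`; weight `w > 0`; second-stage proposal ANY Markov kernel `R`; the two-stage move mass
## `m_R(x) = A(x) + ∫∫ d(x, y₁, z) R(x, dz) q(dy₁)` as in `IMHDelayedRejectionReversibleSecondStage`)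

## Results [all ours]

* `drSecond_ge_of_weight_ge`: if `w(z) ≥ (1 − ε)·w(x)` then `d(x, y₁, z) ≥ (1 − a(x, y₁)) − ε` — a local move onto a comparably heavy configuration is
  accepted in the second stage with (almost) the full first-stage rejection probability.
* **`drLocal_mass_ge`**: if `R(x, ·)` is carried by `{z : w(z) ≥ (1 − ε)w(x)}` (the local move loses at most a factor `1 − ε` of the weight from `x`)
  then `m_R(x) ≥ 1 − ε`: EVERY update from `x` moves with probability at least `1 − ε`, whatever `A(x)` — the first stage supplies the global jumps
  when they are accepted, the second stage a local step otherwise.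
* `drLocal_mass_ge_of_forall`: the uniform version (`R(x, ·)` carried by the `(1 − ε)`-plateau of `x` for every `x`).
Exactness of the scheme is `delayedRejectionR_invariant` (when `R` is reversible for the flow law); this file is the rate-side complement.
-/

namespace Summit.Ventures.LatticeQCDFlow.Exactness

open MeasureTheory ProbabilityTheory
open scoped ENNReal

variable {Ω : Type*} [MeasurableSpace Ω] {q : Measure Ω} [IsProbabilityMeasure q] {w : Ω → ℝ}

/-! ## §1 The second stage onto a comparably heavy configuration -/

omit [MeasurableSpace Ω] in
/-- **`w(z) ≥ (1 − ε)w(x)` ⇒ `d(x, y₁, z) ≥ (1 − a(x, y₁)) − ε`** (real form, `ε ≥ 0`). [ours] -/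
theorem drSecond_ge_of_weight_ge_real (hw0 : ∀ x, 0 < w x) {ε : ℝ} (hε : 0 ≤ ε) {x y₁ z : Ω} (hz : (1 - ε) * w x ≤ w z) :
    (1 - imhAccept w x y₁) - ε ≤ min (1 - imhAccept w x y₁) (w z * (1 - imhAccept w z y₁) / w x) := by
  have hx := hw0 x
  have key : max (w x - w y₁) 0 ≤ max (min (w x) (w z) - w y₁) 0 + ε * w x := by
    have hmin : (1 - ε) * w x ≤ min (w x) (w z) := le_min (by nlinarith [hx, hε]) hz
    rcases le_or_gt (w x) (w y₁) with h | h
    · rw [max_eq_right (by linarith)]; nlinarith [le_max_right (min (w x) (w z) - w y₁) 0, hx, hε]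
    · rw [max_eq_left (by linarith)]; nlinarith [le_max_left (min (w x) (w z) - w y₁) 0, hmin]
  have hdiv := div_le_div_of_nonneg_right key hx.le
  rw [add_div, mul_div_assoc, div_self hx.ne', mul_one] at hdiv
  rw [drSecond_eq_posPart hw0, one_sub_imhAccept_eq hw0]
  linarith

omit [MeasurableSpace Ω] in
/-- The same in `ℝ≥0∞`: `ofReal (1 − a(x, y₁)) − ofReal ε ≤ ofReal d(x, y₁, z)`. [ours] -/
theorem drSecond_ge_of_weight_ge (hw0 : ∀ x, 0 < w x) {ε : ℝ} (hε : 0 ≤ ε) {x y₁ z : Ω} (hz : (1 - ε) * w x ≤ w z) :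
    ENNReal.ofReal (1 - imhAccept w x y₁) - ENNReal.ofReal ε ≤
      ENNReal.ofReal (min (1 - imhAccept w x y₁) (w z * (1 - imhAccept w z y₁) / w x)) := by
  rw [tsub_le_iff_right]
  calc ENNReal.ofReal (1 - imhAccept w x y₁)
      ≤ ENNReal.ofReal (min (1 - imhAccept w x y₁) (w z * (1 - imhAccept w z y₁) / w x) + ε) :=
        ENNReal.ofReal_le_ofReal (by linarith [drSecond_ge_of_weight_ge_real hw0 hε (y₁ := y₁) hz])
    _ ≤ ENNReal.ofReal (min (1 - imhAccept w x y₁) (w z * (1 - imhAccept w z y₁) / w x)) + ENNReal.ofReal ε :=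
        ENNReal.ofReal_add_le

/-! ## §2 The move mass of the global-first-local-second sampler -/

/-- `∫ ofReal (1 − a(x, ·)) dq = 1 − A(x)`. [ours, bookkeeping] -/
theorem lintegral_ofReal_one_sub_imhAccept (hw : Measurable w) (hw0 : ∀ x, 0 < w x) (x : Ω) :
    ∫⁻ y, ENNReal.ofReal (1 - imhAccept w x y) ∂q = 1 - imhAcceptMass q w x := by
  have h1 : ∀ y, ENNReal.ofReal (1 - imhAccept w x y) = 1 - imhAcceptE w x y := fun y => by
    rw [imhAcceptE, ENNReal.ofReal_sub _ (imhAccept_nonneg hw0 x y), ENNReal.ofReal_one]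
  simp_rw [h1]
  exact lintegral_one_sub_eq ((measurable_imhAcceptE hw).of_uncurry_left) (imhAcceptE_le_one w x)

/-- **GLOBAL FIRST, LOCAL SECOND DOES NOT STICK**: if the second-stage kernel from `x` is carried by the plateau `{z : (1 − ε)w(x) ≤ w(z)}`, then the
two-stage move mass satisfies `m_R(x) = A(x) + ∫∫ d(x, y₁, z) R(x, dz) q(dy₁) ≥ 1 − ε`. [ours] -/
theorem drLocal_mass_ge (hw : Measurable w) (hw0 : ∀ x, 0 < w x) {ε : ℝ} (hε : 0 ≤ ε) (R : Kernel Ω Ω) [IsMarkovKernel R] (x : Ω)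
    (hR : ∀ᵐ z ∂(R x), (1 - ε) * w x ≤ w z) :
    ENNReal.ofReal (1 - ε) ≤ imhAcceptMass q w x +
      ∫⁻ y₁, ∫⁻ z, ENNReal.ofReal (min (1 - imhAccept w x y₁) (w z * (1 - imhAccept w z y₁) / w x)) ∂(R x) ∂q := by
  have hrej : Measurable fun y => ENNReal.ofReal (1 - imhAccept w x y) := by
    have : Measurable fun y => imhAccept w x y := by
      unfold imhAccept; exact measurable_const.min ((hw).div measurable_const)
    exact (measurable_const.sub this).ennreal_ofReal
  -- second stage from `x`: at least `(1 − a(x, y₁)) − ε` for `R(x, ·)`-a.e. `z`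
  have hinner : ∀ y₁, ENNReal.ofReal (1 - imhAccept w x y₁) - ENNReal.ofReal ε ≤
      ∫⁻ z, ENNReal.ofReal (min (1 - imhAccept w x y₁) (w z * (1 - imhAccept w z y₁) / w x)) ∂(R x) := fun y₁ => by
    calc ENNReal.ofReal (1 - imhAccept w x y₁) - ENNReal.ofReal ε
        = ∫⁻ _z, (ENNReal.ofReal (1 - imhAccept w x y₁) - ENNReal.ofReal ε) ∂(R x) := by
          rw [lintegral_const, measure_univ, mul_one]
      _ ≤ ∫⁻ z, ENNReal.ofReal (min (1 - imhAccept w x y₁) (w z * (1 - imhAccept w z y₁) / w x)) ∂(R x) :=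
          lintegral_mono_ae (hR.mono fun z hz => drSecond_ge_of_weight_ge hw0 hε hz)
  have hstage2 : (1 - imhAcceptMass q w x) - ENNReal.ofReal ε ≤
      ∫⁻ y₁, ∫⁻ z, ENNReal.ofReal (min (1 - imhAccept w x y₁) (w z * (1 - imhAccept w z y₁) / w x)) ∂(R x) ∂q := by
    calc (1 - imhAcceptMass q w x) - ENNReal.ofReal ε
        = ∫⁻ y₁, ENNReal.ofReal (1 - imhAccept w x y₁) ∂q - ∫⁻ _y₁, ENNReal.ofReal ε ∂q := by
          rw [lintegral_ofReal_one_sub_imhAccept hw hw0 x, lintegral_const, measure_univ, mul_one]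
      _ ≤ ∫⁻ y₁, (ENNReal.ofReal (1 - imhAccept w x y₁) - ENNReal.ofReal ε) ∂q := lintegral_sub_le _ _ measurable_const
      _ ≤ _ := lintegral_mono fun y₁ => hinner y₁
  calc ENNReal.ofReal (1 - ε) = 1 - ENNReal.ofReal ε := by rw [ENNReal.ofReal_sub _ hε, ENNReal.ofReal_one]
    _ = imhAcceptMass q w x + (1 - imhAcceptMass q w x) - ENNReal.ofReal ε := by
        rw [add_tsub_cancel_of_le (imhAcceptMass_le_one q w x)]
    _ ≤ imhAcceptMass q w x + ((1 - imhAcceptMass q w x) - ENNReal.ofReal ε) := add_tsub_le_assoc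
    _ ≤ _ := add_le_add le_rfl hstage2

/-- **The uniform version**: if from EVERY configuration the local move keeps at least the fraction `1 − ε` of the weight, every update of the
global-first-local-second sampler moves with probability `≥ 1 − ε`. [ours] -/
theorem drLocal_mass_ge_of_forall (hw : Measurable w) (hw0 : ∀ x, 0 < w x) {ε : ℝ} (hε : 0 ≤ ε) (R : Kernel Ω Ω) [IsMarkovKernel R]
    (hR : ∀ x, ∀ᵐ z ∂(R x), (1 - ε) * w x ≤ w z) (x : Ω) :
    ENNReal.ofReal (1 - ε) ≤ imhAcceptMass q w x +
      ∫⁻ y₁, ∫⁻ z, ENNReal.ofReal (min (1 - imhAccept w x y₁) (w z * (1 - imhAccept w z y₁) / w x)) ∂(R x) ∂q :=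
  drLocal_mass_ge hw hw0 hε R x (hR x)

end Summit.Ventures.LatticeQCDFlow.Exactness
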